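import Literature.Analysis.FunctionSpaces.TorusLerayHelmholtz
import Literature.Analysis.FunctionSpaces.TorusInverseLaplacianCalculus
import HarnessLib

/-!
# The smooth Leray–Helmholtz projection `v ↦ v - ∇Δ⁻¹div v` on `T^d`: divergence, mean, and the
# `L²`- and `H¹`-contraction properties

Analysis/FunctionSpaces support file (everything proved; no definitions, no named facts), sequel of
`TorusLerayHelmholtz.lean` (Pythagoras `∫‖w + ∇φ‖² = ∫‖w‖² + ∫‖∇φ‖²` for smooth divergence-free `w`,
linearity of `∇`, `div` on differences) and `TorusInverseLaplacianCalculus.lean` (the smooth inverse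
Laplacian `Δ⁻¹`, `Δ Δ⁻¹ h = h - ∫h`, linearity, `∂ⱼΔ⁻¹ = Δ⁻¹∂ⱼ`). On smooth vector fields the
**Leray–Helmholtz projection** is the honest operator

  `P v := v - ∇Δ⁻¹(div v)`

(Robinson–Rodrigo–Sadowski 2016, Def. 2.8 with Thm. 2.6: `u = ℙu + ∇g`, `g = Δ⁻¹ div u`; Luo–Titi 2020,
§3.3, "`P_LH = Id - ∇Δ⁻¹div`"; it is the `FluidPDE`-side definition `FluidPDE.Torus.lerayHelmholtz` of
`TorusLpOperatorFacts`, which this function-space file does not import — every statement below is about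
the expanded expression `fun x => v x - Torus.gradient (invLaplacian (divergence v)) x`, definitionally
`lerayHelmholtz v`). We prove, for smooth `v : T^d → ℝ^d`:

* `Torus.partialDeriv_gradient_comm`, `Torus.divergence_partialDeriv_comm`,
  `Torus.divergence_gradient_eq_laplacian_apply`, `Torus.IsDivFree.partialDeriv_of_isSmooth` — the
  commutation rules `∂ⱼ∇ = ∇∂ⱼ`, `div ∂ⱼ = ∂ⱼ div`, `div ∇ = Δ` (Schwarz), and "derivatives of
  divergence-free fields are divergence free";
* `Torus.isSmooth_sub_gradient_invLaplacian_divergence`, `Torus.isDivFree_sub_gradient_invLaplacian_divergence`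
  (`div P v = div v - (div v - ∫ div v) = 0`, RRS Thm. 2.6 / Luo–Titi §3.3),
  `Torus.integral_sub_gradient_invLaplacian_divergence` (`∫ P v = ∫ v`: `P` keeps the mean);
* `Torus.gradNormSq_add_gradient` — **Pythagoras at the `H¹` level**: for smooth divergence-free `w`
  and smooth `φ`, `‖∇(w + ∇φ)‖₂² = ‖∇w‖₂² + ‖∇∇φ‖₂²` (apply the `L²` Pythagoras of
  `TorusLerayHelmholtz` to `∂ᵢ(w + ∇φ) = ∂ᵢw + ∇(∂ᵢφ)`, `∂ᵢw` divergence free, and sum over `i`);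
* `Torus.integral_norm_sq_sub_gradient_invLaplacian_divergence_le`,
  `Torus.gradNormSq_sub_gradient_invLaplacian_divergence_le` — **`P` is an `L²`- and an
  `H¹`-contraction**: `∫ ‖P v‖² ≤ ∫ ‖v‖²`, `‖∇(P v)‖₂² ≤ ‖∇v‖₂²` (RRS 2016, Thm. 2.6:
  `‖h‖² + ‖∇g‖² = ‖u‖²`, and Lemma 2.9: `ℙ` commutes with derivatives; equivalently, the Fourier
  multiplier of `ℙ` is the orthogonal projection onto `k^⊥`, of norm `≤ 1`, on every mode);
* `Torus.sub_gradient_invLaplacian_divergence_sub` — linearity on differences,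
  `P v₁ - P v₂ = P (v₁ - v₂)` pointwise, whence the contraction estimates for differences
  `Torus.integral_norm_sq_leray_sub_le`, `Torus.gradNormSq_leray_sub_le`.

These are the `H¹`-level mapping properties of the projected nonlinearity `P((u·∇)u)` of the
Navier–Stokes equations in the functional setting `u' = νΔu - P((u·∇)u)` (Constantin–Foias 1988, Ch. 5;
RRS 2016, Ch. 5), consumed by continuity estimates of the Navier–Stokes vector field on sets of smooth
fields (`FluidPDE/TorusNSVectorFieldHolder.lean`).

## Mathlib / tree search

Tree (reused): `Torus.integral_norm_sq_add_gradient`, `Torus.gradient_sub`, `Torus.divergence_sub`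
(`TorusLerayHelmholtz`), `Torus.invLaplacian_sub`, `Torus.laplacian_invLaplacian`, `Torus.isSmooth_invLaplacian`
(`TorusInverseLaplacian(Calculus)`), `Torus.gradient_eq_sum_partialDeriv` (`TorusSpaceTime`),
`Torus.partialDeriv_comm`, `Torus.partialDeriv_finset_sum`, `Torus.partialDeriv_apply_coord`
(`TorusEnstrophyOrthogonality`), `Torus.partialDeriv_smul` (`TorusCalculusProofs`), `Torus.partialDeriv_add`
(`TorusTestFunction`), `Torus.integral_divergence_eq_zero_holds`, `Torus.integral_gradient_eq_zero`.
Searched `partialDeriv.*gradient`, `divergence.*partialDeriv`, `gradNormSq.*gradient`, `lerayHelmholtz`: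
the commutation rules exist only in `FluidPDE` files (`CompressibleEulerLinearizedDerivative.partialDeriv_gradient_eq`,
`….partialDeriv_divergence_eq`, `TorusLpOperatorFacts.divergence_gradient`, `isDivFree_lerayHelmholtz`), not
importable into `FunctionSpaces`; re-derived here in a few lines each (adapted, with comments). No `H¹`
contraction of the projection anywhere in the tree. Mathlib has no torus Leray projector.

## References

* J. C. Robinson, J. L. Rodrigo, W. Sadowski, *The Three-Dimensional Navier–Stokes Equations*, CUP 2016,
  §2.1: Thm. 2.6, Def. 2.8, Lemma 2.9. [RobinsonRodrigoSadowskiCUP2016]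
* T. Luo, E. S. Titi, Calc. Var. PDE 59 (2020), §3.3 (`P_LH = Id - ∇Δ⁻¹div`). [LuoTiti2020]
* P. Constantin, C. Foias, *Navier–Stokes Equations*, Univ. Chicago Press 1988, Ch. 5.
  [ConstantinFoiasNSE1988]
-/

noncomputable section

open _root_.MeasureTheory Set Filter Function
open scoped InnerProductSpace ContDiff

namespace Literature.Analysis.FunctionSpaces

namespace Torus

variable {d : Type*} [Fintype d] [DecidableEq d]

/-! ### Commutation of `∂ⱼ` with `∇` and `div`; `div ∇ = Δ` -/

/-- **`∂ⱼ(∇φ) = ∇(∂ⱼφ)`** for a smooth scalar `φ` on `T^d` (`∇φ = ∑ᵢ ∂ᵢφ eᵢ` and Schwarz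
`∂ⱼ∂ᵢ = ∂ᵢ∂ⱼ`; RRS 2016, Lemma 2.9 ingredient). [folklore] -/
theorem partialDeriv_gradient_comm {φ : UnitAddTorus d → ℝ} (hφ : IsSmooth φ) (j : d) (x : UnitAddTorus d) :
    partialDeriv j (Torus.gradient φ) x = Torus.gradient (partialDeriv j φ) x := by
  -- adapted from `CompressibleEulerLinearizedDerivative.partialDeriv_gradient_eq` (FluidPDE, not imported)
  have e : Torus.gradient φ = fun y => ∑ i, partialDeriv i φ y • EuclideanSpace.single i (1 : ℝ) :=
    funext fun y => gradient_eq_sum_partialDeriv (hφ.isContDiff (by simp)) y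
  have hs : ∀ i, IsContDiff 1 (fun y => partialDeriv i φ y • EuclideanSpace.single i (1 : ℝ)) := fun i =>
    ContDiff.smul ((hφ.partialDeriv i).isContDiff (by simp)) (isContDiff_const _)
  rw [e, partialDeriv_finset_sum _ (fun i _ => hs i),
    gradient_eq_sum_partialDeriv ((hφ.partialDeriv j).isContDiff (by simp))]
  refine Finset.sum_congr rfl fun i _ => ?_
  have h0 : partialDeriv j (fun _ : UnitAddTorus d => EuclideanSpace.single i (1 : ℝ)) x = 0 := by
    simp [partialDeriv, Torus.lineDeriv]
  rw [partialDeriv_smul ((hφ.partialDeriv i).isContDiff (by simp)) (isContDiff_const _) j x, h0,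
    smul_zero, zero_add, partialDeriv_comm hφ j i x]

/-- **`div(∂ⱼw) = ∂ⱼ(div w)`** for a smooth field `w` on `T^d` (coordinates commute with `∂ⱼ`,
and Schwarz). [folklore] -/
theorem divergence_partialDeriv_comm {w : UnitAddTorus d → EuclideanSpace ℝ d} (hw : IsSmooth w) (j : d)
    (x : UnitAddTorus d) :
    divergence (partialDeriv j w) x = partialDeriv j (divergence w) x := by
  -- adapted from `CompressibleEulerLinearizedDerivative.partialDeriv_divergence_eq` (FluidPDE, not imported)
  have e : divergence w = fun y => ∑ i, partialDeriv i (fun z => w z i) y := by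
    funext y; simp only [divergence]
  rw [e, partialDeriv_finset_sum _ (fun i _ => ((hw.apply i).partialDeriv i).isContDiff (by simp))]
  simp only [divergence]
  refine Finset.sum_congr rfl fun i _ => ?_
  have hc : (fun y => partialDeriv j w y i) = partialDeriv j (fun z => w z i) :=
    funext fun y => (partialDeriv_apply_coord (hw.isContDiff (by simp)) j y i).symm
  rw [hc, partialDeriv_comm (hw.apply i) i j x]

/-- **Derivatives of smooth divergence-free fields are divergence free**: `div(∂ⱼw) = ∂ⱼ(div w) = 0`.
[folklore] -/
theorem IsDivFree.partialDeriv_of_isSmooth {w : UnitAddTorus d → EuclideanSpace ℝ d} (hw : IsSmooth w)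
    (hdiv : IsDivFree w) (j : d) : IsDivFree (partialDeriv j w) := by
  intro x
  have h0 : divergence w = fun _ => (0 : ℝ) := funext hdiv
  rw [divergence_partialDeriv_comm hw j x, h0]
  simp [partialDeriv, Torus.lineDeriv]

/-- **`div ∇φ = Δφ`** for a smooth scalar on `T^d` (`(∇φ)ᵢ = ∂ᵢφ`, `Δ = ∑ᵢ ∂ᵢ∂ᵢ`; twin of
`FluidPDE.Torus.divergence_gradient` / `divergence_gradient_eq_laplacian`, not importable here). [folklore] -/
theorem divergence_gradient_eq_laplacian_apply {φ : UnitAddTorus d → ℝ} (hφ : IsSmooth φ) (x : UnitAddTorus d) :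
    divergence (Torus.gradient φ) x = laplacian φ x := by
  rw [laplacian_eq_sum_partialDeriv_partialDeriv hφ, divergence]
  refine Finset.sum_congr rfl fun i _ => ?_
  have hc : (fun y => Torus.gradient φ y i) = partialDeriv i φ := by
    funext y
    rw [gradient_eq_sum_partialDeriv (hφ.isContDiff (by simp)) y]
    simp [Pi.single_apply]
  rw [hc]

/-! ### The projection `P v = v - ∇Δ⁻¹ div v`: smoothness, divergence, mean -/

section Projection

variable {v : UnitAddTorus d → EuclideanSpace ℝ d}

/-- `P v = v - ∇Δ⁻¹div v` is smooth for smooth `v`. [folklore] -/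
theorem isSmooth_sub_gradient_invLaplacian_divergence (hv : IsSmooth v) :
    IsSmooth (fun x => v x - Torus.gradient (invLaplacian (divergence v)) x) :=
  hv.sub (isSmooth_invLaplacian hv.divergence).gradient

/-- **`P v` is divergence free** (`d` nonempty): `div(v - ∇Δ⁻¹div v) = div v - Δ Δ⁻¹ div v
= div v - (div v - ∫ div v) = ∫ div v = 0` (Robinson–Rodrigo–Sadowski 2016, Thm. 2.6; Luo–Titi 2020,
§3.3). [cite: RobinsonRodrigoSadowskiCUP2016, Thm. 2.6 (pp. 43–44)] -/
theorem isDivFree_sub_gradient_invLaplacian_divergence [Nonempty d] (hv : IsSmooth v) :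
    IsDivFree (fun x => v x - Torus.gradient (invLaplacian (divergence v)) x) := by
  -- adapted from `FluidPDE.Torus.isDivFree_lerayHelmholtz` (`TorusLpOperatorFacts`, not imported)
  intro x
  have hφ : IsSmooth (invLaplacian (divergence v)) := isSmooth_invLaplacian hv.divergence
  rw [show (fun x => v x - Torus.gradient (invLaplacian (divergence v)) x) =
      v - Torus.gradient (invLaplacian (divergence v)) from rfl,
    divergence_sub (hv.isContDiff (by simp)) (hφ.gradient.isContDiff (by simp)),
    divergence_gradient_eq_laplacian_apply hφ, laplacian_invLaplacian hv.divergence,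
    integral_divergence_eq_zero_holds hv]
  ring

/-- **`P` keeps the mean**: `∫ (v - ∇Δ⁻¹div v) = ∫ v` (gradients have zero mean). [folklore] -/
theorem integral_sub_gradient_invLaplacian_divergence (hv : IsSmooth v) :
    ∫ x, (v x - Torus.gradient (invLaplacian (divergence v)) x) = ∫ x, v x := by
  have hφ : IsSmooth (invLaplacian (divergence v)) := isSmooth_invLaplacian hv.divergence
  rw [integral_sub hv.integrable hφ.gradient.integrable, integral_gradient_eq_zero hφ, sub_zero]

/-- `P v` has zero mean iff `v` has. [folklore] -/
theorem hasZeroMean_sub_gradient_invLaplacian_divergence_iff (hv : IsSmooth v) :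
    HasZeroMean (fun x => v x - Torus.gradient (invLaplacian (divergence v)) x) ↔ HasZeroMean v := by
  unfold HasZeroMean
  rw [integral_sub_gradient_invLaplacian_divergence hv]

end Projection

/-! ### Pythagoras at the `H¹` level -/

/-- **`‖∇(w + ∇φ)‖₂² = ‖∇w‖₂² + ‖∇(∇φ)‖₂²` for smooth divergence-free `w` and smooth `φ`**
(`∂ᵢ(w + ∇φ) = ∂ᵢw + ∇∂ᵢφ` with `∂ᵢw` divergence free, the `L²` Pythagoras
`Torus.integral_norm_sq_add_gradient` for each `i`, summed; RRS 2016, Thm. 2.6 with Lemma 2.9).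
[cite: RobinsonRodrigoSadowskiCUP2016, Thm. 2.6 and Lemma 2.9 (pp. 43–45)] -/
theorem gradNormSq_add_gradient {w : UnitAddTorus d → EuclideanSpace ℝ d} {φ : UnitAddTorus d → ℝ}
    (hw : IsSmooth w) (hdiv : IsDivFree w) (hφ : IsSmooth φ) :
    gradNormSq (fun x => w x + Torus.gradient φ x) =
      gradNormSq w + gradNormSq (Torus.gradient φ) := by
  have hg : IsSmooth (Torus.gradient φ) := hφ.gradient
  have hs : IsSmooth (fun x => w x + Torus.gradient φ x) := hw.add hg
  have hi : ∀ i, partialDeriv i (fun x => w x + Torus.gradient φ x) =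
      fun x => partialDeriv i w x + Torus.gradient (partialDeriv i φ) x := fun i => by
    rw [show (fun x => w x + Torus.gradient φ x) = w + Torus.gradient φ from rfl,
      partialDeriv_add (hw.isContDiff (by simp)) (hg.isContDiff (by simp))]
    funext x
    rw [Pi.add_apply, partialDeriv_gradient_comm hφ i x]
  have hgi : ∀ i, partialDeriv i (Torus.gradient φ) = Torus.gradient (partialDeriv i φ) := fun i =>
    funext fun x => partialDeriv_gradient_comm hφ i x
  rw [gradNormSq, gradNormSq, gradNormSq,
    integral_finsetSum _ fun i _ => ((hs.partialDeriv i).norm_sq).integrable,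
    integral_finsetSum _ fun i _ => ((hw.partialDeriv i).norm_sq).integrable,
    integral_finsetSum _ fun i _ => ((hg.partialDeriv i).norm_sq).integrable, ← Finset.sum_add_distrib]
  refine Finset.sum_congr rfl fun i _ => ?_
  rw [hi i, hgi i]
  exact integral_norm_sq_add_gradient (hw.partialDeriv i) (hdiv.partialDeriv_of_isSmooth hw i)
    (hφ.partialDeriv i)

/-! ### The projection is an `L²`- and an `H¹`-contraction -/

section Contraction

variable {v : UnitAddTorus d → EuclideanSpace ℝ d}

/-- **`∫ ‖P v‖² ≤ ∫ ‖v‖²`** for smooth `v` (`d` nonempty): `v = P v + ∇Δ⁻¹div v` with `P v`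
divergence free, so `∫‖v‖² = ∫‖Pv‖² + ∫‖∇Δ⁻¹div v‖²` (Robinson–Rodrigo–Sadowski 2016, Thm. 2.6:
`‖h‖² + ‖∇g‖² = ‖u‖²`). [cite: RobinsonRodrigoSadowskiCUP2016, Thm. 2.6 (pp. 43–44)] -/
theorem integral_norm_sq_sub_gradient_invLaplacian_divergence_le [Nonempty d] (hv : IsSmooth v) :
    ∫ x, ‖v x - Torus.gradient (invLaplacian (divergence v)) x‖ ^ 2 ≤ ∫ x, ‖v x‖ ^ 2 := by
  have hφ : IsSmooth (invLaplacian (divergence v)) := isSmooth_invLaplacian hv.divergence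
  have hP := isSmooth_sub_gradient_invLaplacian_divergence hv
  have hdec : (fun x => ‖v x‖ ^ 2) = fun x => ‖(v x - Torus.gradient (invLaplacian (divergence v)) x) +
      Torus.gradient (invLaplacian (divergence v)) x‖ ^ 2 := by
    funext x; rw [sub_add_cancel]
  rw [hdec, integral_norm_sq_add_gradient hP (isDivFree_sub_gradient_invLaplacian_divergence hv) hφ]
  have h0 : 0 ≤ ∫ x, ‖Torus.gradient (invLaplacian (divergence v)) x‖ ^ 2 :=
    integral_nonneg fun x => sq_nonneg _
  linarith

/-- **`‖∇(P v)‖₂² ≤ ‖∇v‖₂²`** for smooth `v` (`d` nonempty): `gradNormSq` of `v = P v + ∇Δ⁻¹div v`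
splits by the `H¹` Pythagoras `Torus.gradNormSq_add_gradient` (RRS 2016, Thm. 2.6 (ii) with Lemma 2.9:
`ℙ` is an orthogonal projection commuting with derivatives, hence of norm `≤ 1` on `Ḣ¹`).
[cite: RobinsonRodrigoSadowskiCUP2016, Thm. 2.6 (ii) and Lemma 2.9 (pp. 43–45)] -/
theorem gradNormSq_sub_gradient_invLaplacian_divergence_le [Nonempty d] (hv : IsSmooth v) :
    gradNormSq (fun x => v x - Torus.gradient (invLaplacian (divergence v)) x) ≤ gradNormSq v := by
  have hφ : IsSmooth (invLaplacian (divergence v)) := isSmooth_invLaplacian hv.divergence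
  have hP := isSmooth_sub_gradient_invLaplacian_divergence hv
  have hdec : v = fun x => (v x - Torus.gradient (invLaplacian (divergence v)) x) +
      Torus.gradient (invLaplacian (divergence v)) x := by
    funext x; rw [sub_add_cancel]
  conv_rhs => rw [hdec]
  rw [gradNormSq_add_gradient hP (isDivFree_sub_gradient_invLaplacian_divergence hv) hφ]
  have h0 := gradNormSq_nonneg (Torus.gradient (invLaplacian (divergence v)))
  linarith

/-- **Linearity of `P` on differences**: `P v₁ x - P v₂ x = P (v₁ - v₂) x` for smooth `v₁, v₂`
(`div`, `Δ⁻¹`, `∇` are linear). [folklore] -/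
theorem sub_gradient_invLaplacian_divergence_sub {v₁ v₂ : UnitAddTorus d → EuclideanSpace ℝ d}
    (hv₁ : IsSmooth v₁) (hv₂ : IsSmooth v₂) (x : UnitAddTorus d) :
    (v₁ x - Torus.gradient (invLaplacian (divergence v₁)) x) -
        (v₂ x - Torus.gradient (invLaplacian (divergence v₂)) x) =
      (v₁ - v₂) x - Torus.gradient (invLaplacian (divergence (v₁ - v₂))) x := by
  have hd : divergence (v₁ - v₂) = divergence v₁ - divergence v₂ :=
    funext fun y => divergence_sub (hv₁.isContDiff (by simp)) (hv₂.isContDiff (by simp)) y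
  rw [hd, invLaplacian_sub hv₁.divergence hv₂.divergence,
    gradient_sub ((isSmooth_invLaplacian hv₁.divergence).isContDiff (by simp))
      ((isSmooth_invLaplacian hv₂.divergence).isContDiff (by simp)), Pi.sub_apply]
  abel

/-- **`L²`-contraction for differences**: `∫ ‖P v₁ - P v₂‖² ≤ ∫ ‖v₁ - v₂‖²` for smooth `v₁, v₂`
(`d` nonempty). [cite: RobinsonRodrigoSadowskiCUP2016, Thm. 2.6 (pp. 43–44)] -/
theorem integral_norm_sq_leray_sub_le [Nonempty d] {v₁ v₂ : UnitAddTorus d → EuclideanSpace ℝ d}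
    (hv₁ : IsSmooth v₁) (hv₂ : IsSmooth v₂) :
    ∫ x, ‖(v₁ x - Torus.gradient (invLaplacian (divergence v₁)) x) -
        (v₂ x - Torus.gradient (invLaplacian (divergence v₂)) x)‖ ^ 2 ≤ ∫ x, ‖v₁ x - v₂ x‖ ^ 2 := by
  simp_rw [sub_gradient_invLaplacian_divergence_sub hv₁ hv₂]
  exact integral_norm_sq_sub_gradient_invLaplacian_divergence_le (hv₁.sub hv₂)

/-- **`H¹`-contraction for differences**: `‖∇(P v₁ - P v₂)‖₂² ≤ ‖∇(v₁ - v₂)‖₂²` for smooth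
`v₁, v₂` (`d` nonempty). [cite: RobinsonRodrigoSadowskiCUP2016, Thm. 2.6 (ii) and Lemma 2.9 (pp. 43–45)] -/
theorem gradNormSq_leray_sub_le [Nonempty d] {v₁ v₂ : UnitAddTorus d → EuclideanSpace ℝ d}
    (hv₁ : IsSmooth v₁) (hv₂ : IsSmooth v₂) :
    gradNormSq (fun x => (v₁ x - Torus.gradient (invLaplacian (divergence v₁)) x) -
        (v₂ x - Torus.gradient (invLaplacian (divergence v₂)) x)) ≤ gradNormSq (v₁ - v₂) := by
  simp_rw [sub_gradient_invLaplacian_divergence_sub hv₁ hv₂]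
  exact gradNormSq_sub_gradient_invLaplacian_divergence_le (hv₁.sub hv₂)

end Contraction

end Torus

end Literature.Analysis.FunctionSpaces

end
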